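import Literature.NumberTheory.Automorphic.ClozelAlgebraicityRatFieldProofs
import Literature.NumberTheory.Automorphic.ClozelAlgebraicityConjugatesProofs
import Literature.NumberTheory.Automorphic.AlgebraicityTwist
import Literature.NumberTheory.Automorphic.ArchParameterUnique
import Literature.NumberTheory.Automorphic.IsAutomorphicAE
import HarnessLib

/-!
# `ι`-independence of "`ρ` is attached to a regular `L`-algebraic cuspidal `π`", modulo Clozel 1990
# (dictionary glue for the crux `DyadicOddResidue.DyadicEisensteinFM`, stmt-Langlands-18741,
# line `ordinary-seed-propagation`; `--supports` file, closes nothing)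

Helper file for the rev-L3 route of stub T1′ of the line through Thorne 2026, Theorem B
(`Literature.NumberTheory.Automorphic.Thorne2026_potentialAutomorphy_GL2_potCrystallineOrdinary`),
which produces, for ONE field isomorphism `ι₀ : ℚ̄_p ≃+* ℂ`, a regular `L`-algebraic cuspidal `π₀`
of `GL_n(𝔸_F)` attached to `ρ : Γ_F → GL_n(ℚ̄_p)` at almost all places
(`SatakeFrobCompatibleAE ι₀ π₀ ρ`: `charpoly ρ(Frob_v) = ∏_j (X - ι₀⁻¹(α_j⁻¹))` for the Satake
parameter `α` of `π₀` at `v`), whereas every stub of the line quantifies over ALL `ι`.  This file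
proves the dictionary step "`∃ ι ⟹ ∀ ι`" CONDITIONALLY on the named fact
`Literature.NumberTheory.Automorphic.Clozel1990_regularAlgebraic` (Clozel 1990, Thm. 3.13: the
`Aut(ℂ)`-conjugates `^σπ` of a regular algebraic cuspidal `π` exist, with `σ`-conjugated unramified
Hecke eigenvalues), taken as a hypothesis `(hC : Clozel1990_regularAlgebraic)`.

## The argument (Clozel 1990, §3.1 and Thm. 3.13; Buzzard–Gee 2014, §5.3)

Put `σ := ι ∘ ι₀⁻¹ ∈ Aut(ℂ)` (a `ℚ`-algebra automorphism, `AlgEquiv.ofRingEquiv`).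
1. NORMALISE.  `π₀` is `L`-algebraic with a regular infinity type, so (uniqueness of the
   archimedean parameter, `HasInfinityType.map_a_eq`) it has ONE infinity type that is both
   `L`-algebraic and regular; its twist `π₁ := π₀ ⊗ |det|^{-(n-1)/2}` (Borel–Jacquet 5.7, tree
   `CuspidalAutomorphicRepData.exists_twist_hasInfinityType`) is REGULAR ALGEBRAIC in Clozel's sense
   (`C`-algebraic and regular, Buzzard–Gee §5.3), with Satake parameters `q_v^{(n-1)/2} α`
   (`HasSatakeParamAt.of_map_mulChar_detTwist_of_cpow`).
2. CONJUGATE.  Clozel's fact gives a cuspidal regular algebraic `π₁'` with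
   `t_{v,i}(π₁') = σ(t_{v,i}(π₁))` at almost all `v`
   (`Clozel1990_regularAlgebraic.exists_isAutConjugate_isRegularAlgebraic`).
3. UN-NORMALISE.  `π' := π₁' ⊗ |det|^{(n-1)/2}` is cuspidal, `L`-algebraic, with a regular
   `L`-algebraic infinity type (`CuspidalAutomorphicRepData.exists_twist_isRegular_isLAlgebraic`).
4. NO SIGN AMBIGUITY.  The integral Hecke eigenvalues of `π₁` are
   `t_{v,i} = (√q_v)^{i(n-i)} e_i(q_v^{(n-1)/2} α) = (√q_v)^{i(n-i)+i(n-1)} e_i(α)`, and the exponent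
   `i(n-i) + i(n-1) = 2 i (n-i) + i (i-1)` is EVEN, so `t_{v,i} = q_v^{k} e_i(α)` with `k ∈ ℕ` and
   `σ(t_{v,i}) = q_v^{k} e_i(σ α)`: the Satake parameter of `π₁'` is `q_v^{(n-1)/2} σ(α)`
   (eigenvalues determine the parameter, `eq_of_heckeEigenvalueOf_eq`), that of `π'` is `σ(α)`,
   and `∏_j (X - ι⁻¹(σ(α_j)⁻¹)) = ∏_j (X - ι₀⁻¹(α_j⁻¹)) = charpoly ρ(Frob_v)`.  (Had one conjugated
   the unitary/`L`-normalised parameters of `π₀` directly, `σ(√q_v)/√q_v = ±1` would have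
   appeared; passing through the `C`-normalised `π₁`, on whose INTEGRAL eigenvalues Clozel's
   `Aut(ℂ)` acts, is exactly what removes it.)

Main results (namespace `Summit.Langlands.Langlands.Theorems.DyadicEisensteinFM`):
* `exists_cuspidal_satakeFrobCompatibleAE_iota_of_iota` — general `n ≥ 1`, any number field;
* `exists_cuspidal_satakeFrobCompatibleAE_of_exists_iota` — the registered `n = 2` shape
  `Clozel1990_regularAlgebraic → ∀ F p ρ hF, (∃ ι₀ π₀, …) → ∀ ι, ∃ π, …` (no `IsTotallyReal F`
  needed: Clozel's theorem is for any number field).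

No definitions, no named facts, no `sorry`; standard axioms.  Nothing here closes the crux.

## References

* L. Clozel, *Motifs et formes automorphes: applications du principe de fonctorialité*, in
  Automorphic forms, Shimura varieties, and L-functions I (Ann Arbor 1988), Academic Press 1990,
  §3.1, Déf. 1.8, 3.12, Thm. 3.13. [Clozel1990]
* K. Buzzard, T. Gee, *The conjectural connections between automorphic representations and Galois
  representations*, LMS Lecture Note Ser. 414 (2014), §3.1, Conj. 3.2.1–3.2.2, §5.3. [BuzzardGee2014]
* A. Borel, H. Jacquet, *Automorphic forms and automorphic representations*, Corvallis 1979, 5.7.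
  [BorelJacquet1979]
-/

set_option linter.dupNamespace false -- project-wide option; `Summit.Langlands.Langlands` is the mandated namespace

noncomputable section

namespace Summit.Langlands.Langlands.Theorems.DyadicEisensteinFM

open Literature.NumberTheory.Automorphic Literature.NumberTheory.GaloisRepresentations
open scoped Classical
open NumberField IsDedekindDomain Filter Polynomial

/-! ## 1. Arithmetic of the normalising factors `q_v^{(n-1)/2}` and `(√q_v)^{i(n-i)}` -/

section Arithmetic

/-- `q^{(n-1)/2} = (√q)^{n-1}` for `n ≥ 1`: the complex power `(q : ℂ) ^ ((n-1)/2)` produced by the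
norm twist `|det|^{-(n-1)/2}` is the `(n-1)`-st power of the real square root used in the Satake
normalisation. [folklore] -/
theorem natCast_cpow_half_pred (q n : ℕ) (hn : n ≠ 0) :
    (q : ℂ) ^ (((((n : ℝ) - 1) / 2 : ℝ)) : ℂ) = (((Real.sqrt q : ℝ)) : ℂ) ^ (n - 1) := by
  have hq : (0 : ℝ) ≤ q := Nat.cast_nonneg q
  rw [← Complex.ofReal_natCast, ← Complex.ofReal_cpow hq, ← Complex.ofReal_pow]
  congr 1
  rw [Real.sqrt_eq_rpow, ← Real.rpow_mul_natCast hq]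
  congr 1
  rw [Nat.cast_sub (Nat.one_le_iff_ne_zero.mpr hn), Nat.cast_one]
  ring

/-- The exponent `i(n-i) + (n-1)i` of `√q_v` in the `i`-th integral Hecke eigenvalue of a
`|det|^{-(n-1)/2}`-twist is even (`= 2 i (n-i) + i (i-1)`), for `i ≤ n`. [folklore] -/
theorem even_satakeExponent {i n : ℕ} (hi : i ≤ n) : Even (i * (n - i) + (n - 1) * i) := by
  rcases Nat.eq_zero_or_pos i with rfl | hi0
  · simp
  have h1 : (n - i) + (n - 1) = 2 * (n - i) + (i - 1) := by omega
  have h2 : i * (n - i) + (n - 1) * i = i * ((n - i) + (n - 1)) := by ring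
  rw [h2, h1, show i * (2 * (n - i) + (i - 1)) = 2 * (i * (n - i)) + i * (i - 1) by ring]
  exact (even_two_mul _).add (Nat.even_mul_pred_self i)

/-- A `ℚ`-algebra automorphism of `ℂ` fixes the even powers `(√q)^{2k} = q^k ∈ ℕ`. [folklore] -/
theorem algEquiv_apply_sqrt_pow (σ : ℂ ≃ₐ[ℚ] ℂ) (q : ℕ) {m : ℕ} (hm : Even m) :
    σ ((((Real.sqrt q : ℝ)) : ℂ) ^ m) = (((Real.sqrt q : ℝ)) : ℂ) ^ m := by
  obtain ⟨k, rfl⟩ := hm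
  have h2 : (((Real.sqrt q : ℝ)) : ℂ) ^ (k + k) = (q : ℂ) ^ k := by
    rw [← two_mul, pow_mul, ← Complex.ofReal_pow, Real.sq_sqrt (Nat.cast_nonneg q),
      Complex.ofReal_natCast]
  rw [h2, map_pow, map_natCast]

/-- Elementary symmetric functions commute with `σ ∈ Aut(ℂ)`: `e_i(σ α) = σ(e_i(α))`. [folklore] -/
theorem esymm_map_algEquiv (σ : ℂ ≃ₐ[ℚ] ℂ) (α : Multiset ℂ) (i : ℕ) :
    (α.map σ).esymm i = σ (α.esymm i) := by
  -- adapted from `Multiset.esymm_map_ringHom` of `Literature/NumberTheory/Automorphic/AutomorphicConjugate.lean`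
  simp only [Multiset.esymm, Multiset.powersetCard_map, Multiset.map_map, Function.comp_def,
    map_multiset_sum, map_multiset_prod]

/-- **The integral Hecke eigenvalues of a `C`-normalised parameter are `Aut(ℂ)`-equivariant.**
For `σ ∈ Aut(ℂ)`, `i ≤ n` and any multiset `α`:
`σ (t_{v,i}((√q_v)^{n-1} α)) = t_{v,i}((√q_v)^{n-1} σ(α))`, because
`t_{v,i}((√q_v)^{n-1} α) = (√q_v)^{i(n-i)+(n-1)i} e_i(α)` with an even exponent
(`even_satakeExponent`). This is the computation showing that no sign `σ(√q_v)/√q_v` enters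
(Clozel 1990, §3.1; Buzzard–Gee 2014, §5.3). [cite: Clozel1990, §3.1 and Thm. 3.13] -/
theorem algEquiv_heckeEigenvalueOf_map_mul {K : Type} [Field K] [NumberField K] {n : ℕ}
    (σ : ℂ ≃ₐ[ℚ] ℂ) (v : HeightOneSpectrum (𝓞 K)) (α : Multiset ℂ) {i : ℕ} (hi : i ≤ n) :
    σ (heckeEigenvalueOf n v
        (α.map ((((Real.sqrt (v.residueCard : ℝ) : ℝ)) : ℂ) ^ (n - 1) * ·)) i) =
      heckeEigenvalueOf n v
        ((α.map σ).map ((((Real.sqrt (v.residueCard : ℝ) : ℝ)) : ℂ) ^ (n - 1) * ·)) i := by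
  rw [heckeEigenvalueOf, heckeEigenvalueOf, esymm_map_const_mul, esymm_map_const_mul,
    esymm_map_algEquiv, ← mul_assoc, ← mul_assoc, ← pow_mul, ← pow_add, map_mul,
    algEquiv_apply_sqrt_pow σ _ (even_satakeExponent hi)]

/-- Undoing a scalar twist: `c' · (c · β) = β` when `c' c = 1`. [folklore] -/
theorem map_mul_map_mul_eq_self (β : Multiset ℂ) {c c' : ℂ} (h : c' * c = 1) :
    (β.map (c * ·)).map (c' * ·) = β := by
  rw [Multiset.map_map]
  conv_rhs => rw [← Multiset.map_id β]
  refine Multiset.map_congr rfl fun a _ => ?_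
  show c' * (c * a) = a
  rw [← mul_assoc, h, one_mul]

end Arithmetic

/-! ## 2. The `C`-normalisation of a regular `L`-algebraic cuspidal `π` -/

section Normalise

variable {n : ℕ} {K : Type} [Field K] [NumberField K] {hcpt : isCompact_glFiniteIntegralLevel n K}

/-- **An `L`-algebraic cuspidal `π` with a regular infinity type has a regular algebraic twist
`π ⊗ |det|^{-(n-1)/2}`** (`n ≥ 1`).  The `L`-algebraic infinity type of `π` is itself regular
(its `a`-multisets are those of any other infinity type of `π`, `HasInfinityType.map_a_eq`), and
twisting by `-(n-1)/2` makes it `C`-algebraic (`isLAlgebraic_iff_isCAlgebraic_twist`) and keeps it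
regular (`IsRegular.twist`).  The twisted datum is `π'.W = |det|^{-(n-1)/2} · W` for the norm-power
Hecke character `χ = ‖·‖^{-(n-1)/2}`.  Buzzard–Gee 2014, §5.3; Borel–Jacquet 1979, 5.7.
[cite: BuzzardGee2014, §5.3] -/
theorem exists_twist_isRegularAlgebraic_of_isLAlgebraic [NeZero n]
    (π : CuspidalAutomorphicRepData n K hcpt) (hL : π.1.IsLAlgebraic)
    (hreg : ∃ T : InfinityType K n, π.1.HasInfinityType T ∧ T.IsRegular) :
    ∃ (χ : HeckeCharacter K) (π' : CuspidalAutomorphicRepData n K hcpt),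
      (∀ x : ideleGroup K, ((χ x : ℂˣ) : ℂ) =
        (Literature.NumberTheory.GaloisRepresentations.ideleNorm x : ℂ) ^ (((-(((n : ℝ) - 1) / 2) : ℝ)) : ℂ)) ∧
      π'.1.W = π.1.W.map (mulChar (detTwist n χ)) ∧
      π'.1.W' = π.1.W'.map (mulChar (detTwist n χ)) ∧ π'.1.IsRegularAlgebraic := by
  obtain ⟨T₀, hT₀, hLT⟩ := hL
  obtain ⟨T, hT, hregT⟩ := hreg
  have hregT₀ : T₀.IsRegular := fun τ => by
    rw [AutomorphicRepData.HasInfinityType.map_a_eq π.1 hT₀ hT τ]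
    exact hregT τ
  obtain ⟨χ, π', hχ, hW, hW', hT'⟩ := π.exists_twist_hasInfinityType (-(((n : ℝ) - 1) / 2)) hT₀
  refine ⟨χ, π', hχ, hW, hW', _, hT', ?_, hregT₀.twist _⟩
  have e : (((-(((n : ℝ) - 1) / 2) : ℝ)) : ℂ) = -(((n : ℂ) - 1) / 2) := by
    push_cast
    ring
  rw [e]
  exact (InfinityType.isLAlgebraic_iff_isCAlgebraic_twist T₀).mp hLT

end Normalise

/-! ## 3. Transport of `SatakeFrobCompatibleAE` from one `ι` to all `ι` -/

section Transport

variable {n : ℕ} {K : Type} [Field K] [NumberField K] {hcpt : isCompact_glFiniteIntegralLevel n K}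
  {p : ℕ} [Fact p.Prime]

/-- **`ι`-independence of automorphy by a regular `L`-algebraic cuspidal `π`, modulo Clozel 1990**
(general `n ≥ 1`, any number field `K`).  Under `Clozel1990_regularAlgebraic`: if `ρ : Γ_K → GL_n(ℚ̄_p)`
is attached via `ι₀` at almost all places to a cuspidal `L`-algebraic `π₀` having a regular infinity
type, then for EVERY `ι : ℚ̄_p ≃+* ℂ` it is attached via `ι` to such a `π` — namely
`π = (^σ(π₀ ⊗ |det|^{-(n-1)/2})) ⊗ |det|^{(n-1)/2}` with `σ = ι ∘ ι₀⁻¹`, whose Satake parameters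
are `σ(α_v)` (see the module docstring for the sign bookkeeping).  Clozel 1990, Thm. 3.13;
Buzzard–Gee 2014, §5.3 and Conj. 3.2.1. [cite: Clozel1990, Thm. 3.13] [cite: BuzzardGee2014, §5.3] -/
theorem exists_cuspidal_satakeFrobCompatibleAE_iota_of_iota (hC : Clozel1990_regularAlgebraic)
    [NeZero n] (ρ : FramedGaloisRep K (PadicAlgCl p) n) {ι₀ : PadicAlgCl p ≃+* ℂ}
    {π₀ : CuspidalAutomorphicRepData n K hcpt} (hL : π₀.1.IsLAlgebraic)
    (hreg : ∃ T : InfinityType K n, π₀.1.HasInfinityType T ∧ T.IsRegular)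
    (hρ : SatakeFrobCompatibleAE ι₀ π₀.1 ρ) (ι : PadicAlgCl p ≃+* ℂ) :
    ∃ π : CuspidalAutomorphicRepData n K hcpt, π.1.IsLAlgebraic ∧
      (∃ T : InfinityType K n, π.1.HasInfinityType T ∧ T.IsRegular) ∧
      SatakeFrobCompatibleAE ι π.1 ρ := by
  -- `σ := ι ∘ ι₀⁻¹ ∈ Aut(ℂ)`
  let e : ℂ ≃+* ℂ := ι₀.symm.trans ι
  let σ : ℂ ≃ₐ[ℚ] ℂ := AlgEquiv.ofRingEquiv (f := e) fun x => e.toRingHom.map_rat_algebraMap x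
  have hσ : ∀ z, σ z = ι (ι₀.symm z) := fun z => rfl
  -- 1. normalise, 2. conjugate (Clozel), 3. un-normalise
  obtain ⟨χ₁, π₁, hχ₁, hW₁, hW₁', hRA⟩ := exists_twist_isRegularAlgebraic_of_isLAlgebraic π₀ hL hreg
  obtain ⟨π₁', hconj, hRA'⟩ := hC.exists_isAutConjugate_isRegularAlgebraic π₁ hRA σ
  obtain ⟨χ₂, π', T', hχ₂, hW₂, hW₂', hT', hT'reg, hT'L⟩ :=
    π₁'.exists_twist_isRegular_isLAlgebraic hRA'
  refine ⟨π', ⟨T', hT', hT'L⟩, ⟨T', hT', hT'reg⟩, ?_⟩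
  -- 4. Satake–Frobenius bookkeeping at almost every place
  have hconj' : ∀ᶠ v : HeightOneSpectrum (𝓞 K) in cofinite, ∃ β β' : Multiset ℂ,
      π₁.1.HasSatakeParamAt v β ∧ π₁'.1.HasSatakeParamAt v β' ∧
        ∀ i ≤ n, heckeEigenvalueOf n v β' i = σ (heckeEigenvalueOf n v β i) := hconj
  filter_upwards [hρ, hconj'] with v ⟨α, hα, hunr, hP⟩ ⟨β, β', hβ, hβ', heig⟩
  have hn : n ≠ 0 := NeZero.ne n
  have hq0 : (v.residueCard : ℂ) ≠ 0 :=
    Nat.cast_ne_zero.mpr (lt_trans zero_lt_one v.one_lt_residueCard).ne'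
  set r : ℂ := (((Real.sqrt (v.residueCard : ℝ) : ℝ)) : ℂ) with hr
  -- the Satake parameter of `π₁ = π₀ ⊗ |det|^{-(n-1)/2}` at `v` is `r^{n-1} α`
  have hc₁ : (v.residueCard : ℂ) ^ (-((((-(((n : ℝ) - 1) / 2) : ℝ)) : ℂ))) = r ^ (n - 1) := by
    rw [Complex.ofReal_neg, neg_neg]
    exact natCast_cpow_half_pred _ _ hn
  have hα₁ := AutomorphicRepData.HasSatakeParamAt.of_map_mulChar_detTwist_of_cpow hχ₁ hW₁ hW₁' hα
  rw [hc₁] at hα₁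
  have hβα : β = α.map (r ^ (n - 1) * ·) :=
    AutomorphicRepData.hasSatakeParamAt_unique_holds π₁.1 hβ hα₁
  -- the Satake parameter of `π₁' = ^σπ₁` at `v` is `r^{n-1} σ(α)` (no sign: even exponents)
  have hβ'eq : β' = (α.map σ).map (r ^ (n - 1) * ·) := by
    refine eq_of_heckeEigenvalueOf_eq (v := v) hβ'.card_eq ?_ fun i hi => ?_
    · rw [Multiset.card_map, Multiset.card_map, hα.card_eq]
    · rw [heig i hi, hβα, algEquiv_heckeEigenvalueOf_map_mul σ v α hi]
  subst hβ'eq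
  -- the Satake parameter of `π' = π₁' ⊗ |det|^{(n-1)/2}` at `v` is `σ(α)`
  have hc' : (v.residueCard : ℂ) ^ (-((((((n : ℝ) - 1) / 2 : ℝ)) : ℂ))) * r ^ (n - 1) = 1 := by
    rw [← natCast_cpow_half_pred _ _ hn, Complex.cpow_neg, inv_mul_cancel₀]
    exact Complex.cpow_ne_zero_iff.mpr (Or.inl hq0)
  have hα' := AutomorphicRepData.HasSatakeParamAt.of_map_mulChar_detTwist_of_cpow hχ₂ hW₂ hW₂' hβ'
  rw [map_mul_map_mul_eq_self _ hc'] at hα'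
  refine ⟨α.map σ, hα', hunr, ?_⟩
  -- `∏ (X - ι⁻¹(σ(a)⁻¹)) = ∏ (X - ι₀⁻¹(a⁻¹))`
  have hpoly : arithFrobPolyOfSatake ι v.residueCard 1 (α.map σ) =
      arithFrobPolyOfSatake ι₀ v.residueCard 1 α := by
    rw [arithFrobPolyOfSatake_one, arithFrobPolyOfSatake_one, Multiset.map_map]
    refine congrArg _ (Multiset.map_congr rfl fun a _ => ?_)
    show X - C (ι.symm (σ a)⁻¹) = X - C (ι₀.symm a⁻¹)
    rw [← map_inv₀ σ a, hσ, RingEquiv.symm_apply_apply]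
  rw [hpoly]
  exact hP

end Transport

/-! ## 4. The registered `n = 2` shape (`∃ ι₀ → ∀ ι`, any prime `p`, any number field) -/

/-- **Dictionary glue "`∃ ι → ∀ ι`" for "classical over `F`"** (rank `2`, any prime `p`, any number
field `F` — in particular a totally real `F′` as produced by Thorne 2026, Thm. B), modulo the named
fact `Clozel1990_regularAlgebraic` (Clozel 1990, Thm. 3.13): if for SOME `ι₀ : ℚ̄_p ≃+* ℂ` some
cuspidal `L`-algebraic `π₀` of `GL₂(𝔸_F)` with a regular infinity type is attached to `ρ` at almost
all places, then for EVERY `ι` there is such a `π`.  This is `F2_IotaIndependence` of the lead's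
rev-L3 reshape (specialise `p := 2` and drop `IsTotallyReal`).
[cite: Clozel1990, Thm. 3.13] [cite: BuzzardGee2014, §5.3 and Conj. 3.2.1] -/
theorem exists_cuspidal_satakeFrobCompatibleAE_of_exists_iota : Literature.NumberTheory.Automorphic.Clozel1990_regularAlgebraic → ∀ (F : Type) [Field F] [NumberField F] (p : ℕ) [Fact p.Prime] (ρ : Literature.NumberTheory.GaloisRepresentations.FramedGaloisRep F (PadicAlgCl p) 2) (hF : Literature.NumberTheory.Automorphic.isCompact_glFiniteIntegralLevel 2 F), (∃ (ι₀ : PadicAlgCl p ≃+* ℂ) (π₀ : Literature.NumberTheory.Automorphic.CuspidalAutomorphicRepData 2 F hF), π₀.1.IsLAlgebraic ∧ (∃ T : Literature.NumberTheory.Automorphic.InfinityType F 2, π₀.1.HasInfinityType T ∧ T.IsRegular) ∧ Literature.NumberTheory.Automorphic.SatakeFrobCompatibleAE ι₀ π₀.1 ρ) → ∀ (ι : PadicAlgCl p ≃+* ℂ), ∃ π : Literature.NumberTheory.Automorphic.CuspidalAutomorphicRepData 2 F hF, π.1.IsLAlgebraic ∧ (∃ T : Literature.NumberTheory.Automorphic.InfinityType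 F 2, π.1.HasInfinityType T ∧ T.IsRegular) ∧ Literature.NumberTheory.Automorphic.SatakeFrobCompatibleAE ι π.1 ρ := by
  intro hC F _ _ p _ ρ hF h ι
  obtain ⟨ι₀, π₀, hL, hreg, hρ⟩ := h
  exact exists_cuspidal_satakeFrobCompatibleAE_iota_of_iota hC ρ hL hreg hρ ι

end Summit.Langlands.Langlands.Theorems.DyadicEisensteinFM

end
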